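import Literature.NumberTheory.Automorphic.OrbitalIntegralHaarAutomorphismTransport   -- ★ §1: half-inner ⇒ Haar preserving; `IsCanonical.classOrbitalIntegral_comp_continuousMulEquiv_eq` and its `𝟙_{e C}` forms
import Literature.NumberTheory.Rogawski1990.RegularOrbitalIntegralLocallyConstantCM   -- ★ `isRegularElt_iff_charpoly_separable_localNonsplitEquiv` (regularity through the one-place model)
import Literature.NumberTheory.Automorphic.LocalUnitaryGroupCongr   -- ★ `cmDatumLocalNonsplitCongr`, ★ `localNonsplitEquiv_localNonsplitCongr`
import Literature.NumberTheory.Automorphic.LocalHermitianRank3Classification   -- ★ `formCongr_scalar_eq_smul`, ★ `coe_units_map_scalar`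
import Literature.NumberTheory.Automorphic.UnitaryUnitOrbitalIntegralFixedPoints   -- ★ `isRegularElt_val_conj` (regularity is a class function on `U(H)(L⁺_v)`)
import HarnessLib

/-!
# Similitude transport of orbital integrals on `U(H)(L⁺_v)`: `Φ(⟦γ⟧, 𝟙_{T C T⁻¹}) = Φ(⟦T⁻¹ γ T⟧, 𝟙_C)`

`L` CM, `v` a finite place of `L⁺` with `w ∣ v` NON-SPLIT, `T ∈ GL_N(L_w)` a local similitude of `H_w`:
`ᵗ(σ_w T) H_w T = a H_w` with `a ≠ 0` and `σ_w a = a`.  Then `e_T := Ad T` is a topological automorphism of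
`U(H)(L⁺_v)` (★ `cmDatumLocalNonsplitCongr`) whose square `Ad(T²) = Ad(a⁻¹ T²)` is INNER (`a⁻¹ T² ∈ U(H)`), so `e_T`
preserves every two-sided Haar measure (★ `map_continuousMulEquiv_eq_self_of_apply_apply_eq_conj`) and transports the
canonically normalised orbital integrals of [Rogawski1990, §4.3]: **`Φ(⟦γ⟧, F ∘ e_T; m) = Φ(⟦e_T γ⟧, F; m)`** for every
regular `γ` (★ `IsCanonical.classOrbitalIntegral_comp_continuousMulEquiv_eq`).  For an ambient level `S ≤ GL_N(L_w)` and
`C_S := {γ | γ_w ∈ S}`: `e_T C_S = C_{T S T⁻¹}`, whence `Φ(⟦γ⟧, 𝟙_{C_{T S T⁻¹}}) = Φ(⟦e_T⁻¹ γ⟧, 𝟙_{C_S})`, and EQUALITY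
`Φ(⟦γ⟧, 𝟙_{C_{T S T⁻¹}}) = Φ(⟦γ⟧, 𝟙_{C_S})` at the classes of elements `γ` with `γ_w` commuting with `T`.

The case in view is Kottwitz's Euler–Poincaré function on `U(Φ₂) ≅ U(1,1)` [Kottwitz1988, §2],
`f_EP = 𝟙_K∕vol K + 𝟙_{K′}∕vol K′ − 𝟙_I∕vol I` with `K = C_{GL₂(𝒪_w)}` hyperspecial and `K′ = C_{d GL₂(𝒪_w) d⁻¹}`,
`d = diag(1, ϖ)` (§3: `ᵗ(σ_w d) Φ₂ d = ϖ Φ₂`), the stabilisers of a self-dual and of a `ϖ`-modular vertex: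
`Φ(⟦γ⟧, 𝟙_{K′}) = Φ(⟦d⁻¹ γ d⟧, 𝟙_K)` for every regular `γ`, and `Φ(⟦γ⟧, 𝟙_{K′}) = Φ(⟦γ⟧, 𝟙_K)` on the diagonal split torus
(the non-elliptic classes), [Rogawski1990, §12.6 p. 174].  The (R2) tokens `K_w = unitaryInt σ_w Φ₂,w`
(`= (glInt 2 L_w).comap U_w.subtype`, ★ `unitaryInt_eq_comap`) and `K′_w = ((glInt 2 L_w).map (MulAut.conj d)).comap U_w.subtype`
pulled back along ★ `localNonsplitEquiv` are `C_S`, `C_{d S d⁻¹}` with `S = glInt 2 L_w` (membership definitionally).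
-/

noncomputable section

open MeasureTheory Measure Topology Filter Set NumberField IsDedekindDomain
open scoped ENNReal NNReal Matrix MatrixGroups

namespace Literature.NumberTheory.Automorphic

open Literature.MeasureTheory.Group
open Literature.NumberTheory.Rogawski1990 (IsRegularElt isRegularElt_iff isRegularElt_conj_iff)

/-! ## §1 `U(H)(L⁺_v)` at a non-split place: `Ad T` for a local similitude `T` with `σ_w`-fixed multiplier -/

namespace UnitaryGroup

section CM

variable (L : Type) [Field L] [NumberField L] [IsCMField L] (N : ℕ) (H : Matrix (Fin N) (Fin N) L)
  {v : HeightOneSpectrum (𝓞 ↥(maximalRealSubfield L))}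
  (w : PlacesOver L v) (hw : IsCMField.complexConj L • w.1 = w.1)
  (T : GL (Fin N) (w.1.adicCompletion L)) {a : w.1.adicCompletion L} (ha : IsUnit a)
  (h : formCongr (galAdicCompletionMap (L := L) (IsCMField.complexConj L) hw) T (placeForm H w.1) = a • placeForm H w.1)

/-- `Ad T` in the one-place model: `(T · T⁻¹)_w ∘ e_w = e_w ∘ cmDatumLocalNonsplitCongr` (★ `localNonsplitEquiv_localNonsplitCongr`).
[cite: PlatonovRapinchuk1994, §2.3] -/
theorem coe_localNonsplitEquiv_cmDatumLocalNonsplitCongr (g : (cmDatum L N H).Local v) :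
    ((localNonsplitEquiv (IsCMField.complexConj L) H (IsCMField.complexConj_ne_one L) w hw
        (cmDatumLocalNonsplitCongr L w hw T ha h g) :
        unitaryGroupOfForm (galAdicCompletionMap (L := L) (IsCMField.complexConj L) hw) (placeForm H w.1)) :
        GL (Fin N) (w.1.adicCompletion L)) =
      T * ((localNonsplitEquiv (IsCMField.complexConj L) H (IsCMField.complexConj_ne_one L) w hw g :
        unitaryGroupOfForm (galAdicCompletionMap (L := L) (IsCMField.complexConj L) hw) (placeForm H w.1)) :
        GL (Fin N) (w.1.adicCompletion L)) * T⁻¹ :=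
  localNonsplitEquiv_localNonsplitCongr (IsCMField.complexConj L) (IsCMField.complexConj_ne_one L) w hw T ha h g

/-- `Ad T⁻¹` in the one-place model: `e_w (cmDatumLocalNonsplitCongr⁻¹ g) = T⁻¹ · e_w g · T`. [cite: PlatonovRapinchuk1994, §2.3] -/
theorem coe_localNonsplitEquiv_cmDatumLocalNonsplitCongr_symm (g : (cmDatum L N H).Local v) :
    ((localNonsplitEquiv (IsCMField.complexConj L) H (IsCMField.complexConj_ne_one L) w hw
        ((cmDatumLocalNonsplitCongr L w hw T ha h).symm g) :
        unitaryGroupOfForm (galAdicCompletionMap (L := L) (IsCMField.complexConj L) hw) (placeForm H w.1)) :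
        GL (Fin N) (w.1.adicCompletion L)) =
      T⁻¹ * ((localNonsplitEquiv (IsCMField.complexConj L) H (IsCMField.complexConj_ne_one L) w hw g :
        unitaryGroupOfForm (galAdicCompletionMap (L := L) (IsCMField.complexConj L) hw) (placeForm H w.1)) :
        GL (Fin N) (w.1.adicCompletion L)) * T := by
  have h1 := coe_localNonsplitEquiv_cmDatumLocalNonsplitCongr L N H w hw T ha h
    ((cmDatumLocalNonsplitCongr L w hw T ha h).symm g)
  rw [ContinuousMulEquiv.apply_symm_apply] at h1
  rw [h1]; group

omit [IsCMField L] in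
include ha in
/-- The multiplier scalar `a • 1 ∈ GL_N(L_w)` is central. [folklore] -/
private theorem unitsMapScalar_mul_comm_aux (x : GL (Fin N) (w.1.adicCompletion L)) :
    Units.map ((Matrix.scalar (Fin N) : w.1.adicCompletion L →+* Matrix (Fin N) (Fin N) (w.1.adicCompletion L)) :
        w.1.adicCompletion L →* Matrix (Fin N) (Fin N) (w.1.adicCompletion L)) ha.unit * x =
      x * Units.map ((Matrix.scalar (Fin N) : w.1.adicCompletion L →+* Matrix (Fin N) (Fin N) (w.1.adicCompletion L)) :
        w.1.adicCompletion L →* Matrix (Fin N) (Fin N) (w.1.adicCompletion L)) ha.unit := by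
  apply Units.ext
  rw [Units.val_mul, Units.val_mul, coe_units_map_scalar, Matrix.smul_mul, Matrix.mul_smul, Matrix.one_mul,
    Matrix.mul_one]

include h in
/-- **`a⁻¹ T² ∈ U(σ_w, H_w)(L_w)`** for a similitude `ᵗ(σ_w T) H_w T = a H_w` with `σ_w a = a`: the multiplier of `T²` is `a²`,
that of the scalar `a⁻¹` is `σ_w(a⁻¹) a⁻¹ = a⁻²`. [cite: PlatonovRapinchuk1994, §2.3] [cite: Jacobowitz1962, §3 Thm. 3.1] -/
theorem scalar_inv_mul_sq_mem_unitaryGroupOfForm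
    (hσa : galAdicCompletionMap (L := L) (IsCMField.complexConj L) hw a = a) :
    (Units.map ((Matrix.scalar (Fin N) : w.1.adicCompletion L →+* Matrix (Fin N) (Fin N) (w.1.adicCompletion L)) :
        w.1.adicCompletion L →* Matrix (Fin N) (Fin N) (w.1.adicCompletion L)) ha.unit)⁻¹ * (T * T) ∈
      unitaryGroupOfForm (galAdicCompletionMap (L := L) (IsCMField.complexConj L) hw) (placeForm H w.1) := by
  -- `formCongr σ (B C) J = formCongr σ C (formCongr σ B J)` and linearity in `J`
  have hmul : ∀ (B C : GL (Fin N) (w.1.adicCompletion L)) (J : Matrix (Fin N) (Fin N) (w.1.adicCompletion L)),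
      formCongr (galAdicCompletionMap (L := L) (IsCMField.complexConj L) hw) (B * C) J =
        formCongr (galAdicCompletionMap (L := L) (IsCMField.complexConj L) hw) C
          (formCongr (galAdicCompletionMap (L := L) (IsCMField.complexConj L) hw) B J) := fun B C J => by
    simp only [formCongr, Units.val_mul, Matrix.map_mul, Matrix.transpose_mul, Matrix.mul_assoc]
  have hsmul : ∀ (B : GL (Fin N) (w.1.adicCompletion L)) (r : w.1.adicCompletion L) (J : Matrix (Fin N) (Fin N) (w.1.adicCompletion L)),
      formCongr (galAdicCompletionMap (L := L) (IsCMField.complexConj L) hw) B (r • J) =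
        r • formCongr (galAdicCompletionMap (L := L) (IsCMField.complexConj L) hw) B J := fun B r J => by
    simp only [formCongr, Matrix.mul_smul, Matrix.smul_mul]
  rw [mem_unitaryGroupOfForm_iff]
  change formCongr (galAdicCompletionMap (L := L) (IsCMField.complexConj L) hw) _ (placeForm H w.1) = placeForm H w.1
  rw [hmul, ← map_inv, formCongr_scalar_eq_smul, hsmul, hmul, h, hsmul, h, smul_smul, smul_smul]
  have hσa' : galAdicCompletionMap (L := L) (IsCMField.complexConj L) hw ((ha.unit⁻¹ : (w.1.adicCompletion L)ˣ) :
      w.1.adicCompletion L) = ((ha.unit⁻¹ : (w.1.adicCompletion L)ˣ) : w.1.adicCompletion L) := by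
    rw [Units.val_inv_eq_inv_val, map_inv₀, IsUnit.unit_spec, hσa]
  rw [hσa']
  have hprod : ((ha.unit⁻¹ : (w.1.adicCompletion L)ˣ) : w.1.adicCompletion L) * ((ha.unit⁻¹ : (w.1.adicCompletion L)ˣ) :
      w.1.adicCompletion L) * a * a = 1 := by
    rw [Units.val_inv_eq_inv_val, IsUnit.unit_spec]
    field_simp [ha.ne_zero]
  rw [hprod, one_smul]

/-- **`(Ad T)² = Ad(a⁻¹ T²)` is INNER**: with `u_T := e_w⁻¹ (a⁻¹ T²) ∈ U(H)(L⁺_v)`,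
`cmDatumLocalNonsplitCongr (cmDatumLocalNonsplitCongr g) = u_T g u_T⁻¹` for all `g`. [cite: PlatonovRapinchuk1994, §2.3] -/
theorem exists_cmDatumLocalNonsplitCongr_apply_apply_eq_conj
    (hσa : galAdicCompletionMap (L := L) (IsCMField.complexConj L) hw a = a) :
    ∃ u : (cmDatum L N H).Local v, ∀ g : (cmDatum L N H).Local v,
      cmDatumLocalNonsplitCongr L w hw T ha h (cmDatumLocalNonsplitCongr L w hw T ha h g) = u * g * u⁻¹ := by
  set eW := localNonsplitEquiv (IsCMField.complexConj L) H (IsCMField.complexConj_ne_one L) w hw with heW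
  set s := Units.map ((Matrix.scalar (Fin N) : w.1.adicCompletion L →+* Matrix (Fin N) (Fin N) (w.1.adicCompletion L)) :
        w.1.adicCompletion L →* Matrix (Fin N) (Fin N) (w.1.adicCompletion L)) ha.unit with hs_def
  have hs : ∀ y : GL (Fin N) (w.1.adicCompletion L), s⁻¹ * y = y * s⁻¹ := fun y => by
    have hsy : s * y = y * s := by rw [hs_def]; exact unitsMapScalar_mul_comm_aux L N w ha y
    rw [inv_mul_eq_iff_eq_mul, ← mul_assoc, hsy, mul_assoc, mul_inv_cancel, mul_one]
  obtain ⟨u, hu⟩ : ∃ u : (cmDatum L N H).Local v, eW u = ⟨_, scalar_inv_mul_sq_mem_unitaryGroupOfForm L N H w hw T ha h hσa⟩ :=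
    ⟨eW.symm ⟨_, scalar_inv_mul_sq_mem_unitaryGroupOfForm L N H w hw T ha h hσa⟩, eW.apply_symm_apply _⟩
  refine ⟨u, fun g => ?_⟩
  apply eW.injective
  -- both sides in the one-place model `U(σ_w, H_w)(L_w) ≤ GL_N(L_w)`
  have key : eW (cmDatumLocalNonsplitCongr L w hw T ha h (cmDatumLocalNonsplitCongr L w hw T ha h g)) =
      eW u * eW g * (eW u)⁻¹ := by
    apply Subtype.ext
    rw [Subgroup.coe_mul, Subgroup.coe_mul, Subgroup.coe_inv, hu, heW, coe_localNonsplitEquiv_cmDatumLocalNonsplitCongr,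
      coe_localNonsplitEquiv_cmDatumLocalNonsplitCongr]
    set x := ((localNonsplitEquiv (IsCMField.complexConj L) H (IsCMField.complexConj_ne_one L) w hw g :
        unitaryGroupOfForm (galAdicCompletionMap (L := L) (IsCMField.complexConj L) hw) (placeForm H w.1)) :
        GL (Fin N) (w.1.adicCompletion L)) with hx_def
    change T * (T * x * T⁻¹) * T⁻¹ = s⁻¹ * (T * T) * x * (s⁻¹ * (T * T))⁻¹
    calc T * (T * x * T⁻¹) * T⁻¹ = ((T * T) * x * (T * T)⁻¹ * s⁻¹) * s := by group
      _ = (s⁻¹ * ((T * T) * x * (T * T)⁻¹)) * s := by rw [hs]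
      _ = s⁻¹ * (T * T) * x * (s⁻¹ * (T * T))⁻¹ := by group
  rw [key, ← map_inv, ← map_mul, ← map_mul]
  rfl

variable [MeasurableSpace ((cmDatum L N H).Local v)] [BorelSpace ((cmDatum L N H).Local v)]

/-- **`(Ad T)_* ν = ν`**: a local similitude with `σ_w`-fixed multiplier acts on `U(H)(L⁺_v)` preserving every two-sided
Haar measure (★ `map_continuousMulEquiv_eq_self_of_apply_apply_eq_conj`: `(Ad T)²` is inner). [cite: DeitmarEchterhoff2014, Thm. 1.5.3] [cite: Kottwitz1988, §2] -/
theorem map_cmDatumLocalNonsplitCongr_eq_self (hσa : galAdicCompletionMap (L := L) (IsCMField.complexConj L) hw a = a)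
    (ν : Measure ((cmDatum L N H).Local v)) [IsHaarMeasure ν] [ν.IsMulRightInvariant] :
    ν.map (cmDatumLocalNonsplitCongr L w hw T ha h) = ν := by
  obtain ⟨u, hu⟩ := exists_cmDatumLocalNonsplitCongr_apply_apply_eq_conj L N H w hw T ha h hσa
  exact map_continuousMulEquiv_eq_self_of_apply_apply_eq_conj ν _ u hu

/-- **`ν (e_T C) = ν C`** for every set `C` and every two-sided Haar measure `ν` — on `U(Φ₂)`: `vol K′ = vol K`.
[cite: Kottwitz1988, §2] [cite: Folland1995, Thm. 2.20] -/
theorem measure_image_cmDatumLocalNonsplitCongr_eq (hσa : galAdicCompletionMap (L := L) (IsCMField.complexConj L) hw a = a)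
    (ν : Measure ((cmDatum L N H).Local v)) [IsHaarMeasure ν] [ν.IsMulRightInvariant] (C : Set ((cmDatum L N H).Local v)) :
    ν (cmDatumLocalNonsplitCongr L w hw T ha h '' C) = ν C :=
  measure_image_eq_of_map_continuousMulEquiv_eq_self ν _ (map_cmDatumLocalNonsplitCongr_eq_self L N H w hw T ha h hσa ν) C

omit [MeasurableSpace ((cmDatum L N H).Local v)] [BorelSpace ((cmDatum L N H).Local v)] in
/-- **`Ad T` preserves regularity**: `T γ_w T⁻¹` is regular semisimple iff `γ_w` is (★ `isRegularElt_iff_charpoly_separable_localNonsplitEquiv`,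
★ `isRegularElt_conj_iff`). [cite: Rogawski1990, §3.1 p. 19] -/
theorem isRegularElt_cmDatumLocalNonsplitCongr_iff (γ : (cmDatum L N H).Local v) :
    IsRegularElt ((cmDatumLocalNonsplitCongr L w hw T ha h γ).val : GL (Fin N) (LocalRing L v)) ↔
      IsRegularElt (γ.val : GL (Fin N) (LocalRing L v)) := by
  have h1 := isRegularElt_iff_charpoly_separable_localNonsplitEquiv (IsCMField.complexConj L) N H
    (IsCMField.complexConj_ne_one L) w hw (cmDatumLocalNonsplitCongr L w hw T ha h γ)
  have h2 := isRegularElt_iff_charpoly_separable_localNonsplitEquiv (IsCMField.complexConj L) N H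
    (IsCMField.complexConj_ne_one L) w hw γ
  rw [← isRegularElt_iff] at h1 h2
  rw [h1, h2, coe_localNonsplitEquiv_cmDatumLocalNonsplitCongr, isRegularElt_conj_iff]

variable [∀ γ : (cmDatum L N H).Local v, MeasurableSpace ((cmDatum L N H).Local v ⧸ Subgroup.centralizer ({γ} : Set ((cmDatum L N H).Local v)))]
  [∀ γ : (cmDatum L N H).Local v, BorelSpace ((cmDatum L N H).Local v ⧸ Subgroup.centralizer ({γ} : Set ((cmDatum L N H).Local v)))]
  (ν : Measure ((cmDatum L N H).Local v)) [IsHaarMeasure ν] [ν.IsMulRightInvariant]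

/-- **HEAD — similitude transport of orbital integrals on `U(H)(L⁺_v)`.**  `L` CM, `v` finite with `w ∣ v` non-split,
`T ∈ GL_N(L_w)` with `ᵗ(σ_w T) H_w T = a H_w`, `a ≠ 0`, `σ_w a = a`, `e_T := Ad T : U(H)(L⁺_v) ≃ₜ* U(H)(L⁺_v)`
(★ `cmDatumLocalNonsplitCongr`), `m` canonical for `(IsRegularElt, ν)` (the families of ★ `RankOneEulerPoincareNonsplit`):
**`Φ(⟦γ⟧, F ∘ e_T; m) = Φ(⟦e_T γ⟧, F; m)`** for every regular `γ` and every `F`.  For `N = 2`, `H = Φ₂`, `T = d = diag(1, ϖ)`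
(`a = ϖ`) this is the symmetry of the tree of `U(1,1)` exchanging self-dual and `ϖ`-modular vertices.
[cite: Rogawski1990, §4.3 (4.3.1) p. 43] [cite: Kottwitz1988, §2] -/
theorem classOrbitalIntegral_comp_cmDatumLocalNonsplitCongr_eq
    (hσa : galAdicCompletionMap (L := L) (IsCMField.complexConj L) hw a = a)
    {m : OrbitalMeasureFamily ((cmDatum L N H).Local v)}
    (hm : m.IsCanonical (fun γ => IsRegularElt (γ.val : GL (Fin N) (LocalRing L v))) ν)
    (γ : (cmDatum L N H).Local v) (hreg : IsRegularElt (γ.val : GL (Fin N) (LocalRing L v)))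
    (F : (cmDatum L N H).Local v → ℂ) :
    classOrbitalIntegral m (F ∘ cmDatumLocalNonsplitCongr L w hw T ha h) (ConjClasses.mk γ) =
      classOrbitalIntegral m F (ConjClasses.mk (cmDatumLocalNonsplitCongr L w hw T ha h γ)) :=
  hm.classOrbitalIntegral_comp_continuousMulEquiv_eq (fun g x hg => isRegularElt_val_conj L N H v g x hg) _
    (map_cmDatumLocalNonsplitCongr_eq_self L N H w hw T ha h hσa ν) hreg
    ((isRegularElt_cmDatumLocalNonsplitCongr_iff L N H w hw T ha h γ).2 hreg) F

/-- **`𝟙_{T C T⁻¹}` form**: `Φ(⟦γ⟧, 𝟙_{e_T C}; m) = Φ(⟦e_T⁻¹ γ⟧, 𝟙_C; m)` for every set `C ⊆ U(H)(L⁺_v)` and every regular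
`γ` (`(e_T⁻¹ γ)_w = T⁻¹ γ_w T`).  With `C = K` hyperspecial and `T = d`: `Φ(⟦γ⟧, 𝟙_{K′}) = Φ(⟦d⁻¹ γ d⟧, 𝟙_K)`, `K′ = d K d⁻¹`.
[cite: Kottwitz1988, §2] [cite: Rogawski1990, §4.3 (4.3.1) p. 43] -/
theorem classOrbitalIntegral_indicator_image_cmDatumLocalNonsplitCongr_eq
    (hσa : galAdicCompletionMap (L := L) (IsCMField.complexConj L) hw a = a)
    {m : OrbitalMeasureFamily ((cmDatum L N H).Local v)}
    (hm : m.IsCanonical (fun γ => IsRegularElt (γ.val : GL (Fin N) (LocalRing L v))) ν)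
    (C : Set ((cmDatum L N H).Local v))
    (γ : (cmDatum L N H).Local v) (hreg : IsRegularElt (γ.val : GL (Fin N) (LocalRing L v))) :
    classOrbitalIntegral m ((cmDatumLocalNonsplitCongr L w hw T ha h '' C).indicator fun _ => (1 : ℂ)) (ConjClasses.mk γ) =
      classOrbitalIntegral m (C.indicator fun _ => (1 : ℂ))
        (ConjClasses.mk ((cmDatumLocalNonsplitCongr L w hw T ha h).symm γ)) := by
  refine hm.classOrbitalIntegral_indicator_image_eq (fun g x hg => isRegularElt_val_conj L N H v g x hg) _
    (map_cmDatumLocalNonsplitCongr_eq_self L N H w hw T ha h hσa ν) C hreg ?_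
  have h1 := (isRegularElt_cmDatumLocalNonsplitCongr_iff L N H w hw T ha h
    ((cmDatumLocalNonsplitCongr L w hw T ha h).symm γ))
  rw [ContinuousMulEquiv.apply_symm_apply] at h1
  exact h1.1 hreg

/-- **Classes commuting with `T`**: if `T` commutes with `γ_w` (e.g. `T = d = diag(1, ϖ)` and `γ` in the diagonal split
torus of `U(Φ₂)`), then `e_T γ = γ` and **`Φ(⟦γ⟧, 𝟙_{e_T C}; m) = Φ(⟦γ⟧, 𝟙_C; m)`** for every `C` — the `K′`- and
`K`-orbital integrals AGREE at such classes (the non-elliptic half of the Euler–Poincaré computation on `U(1,1)`).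
[cite: Kottwitz1988, §2] [cite: Rogawski1990, §4.3 (4.3.1) p. 43] -/
theorem classOrbitalIntegral_indicator_image_cmDatumLocalNonsplitCongr_eq_of_commute
    (hσa : galAdicCompletionMap (L := L) (IsCMField.complexConj L) hw a = a)
    {m : OrbitalMeasureFamily ((cmDatum L N H).Local v)}
    (hm : m.IsCanonical (fun γ => IsRegularElt (γ.val : GL (Fin N) (LocalRing L v))) ν)
    (C : Set ((cmDatum L N H).Local v))
    (γ : (cmDatum L N H).Local v) (hreg : IsRegularElt (γ.val : GL (Fin N) (LocalRing L v)))
    (hcomm : Commute T ((localNonsplitEquiv (IsCMField.complexConj L) H (IsCMField.complexConj_ne_one L) w hw γ :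
        unitaryGroupOfForm (galAdicCompletionMap (L := L) (IsCMField.complexConj L) hw) (placeForm H w.1)) :
        GL (Fin N) (w.1.adicCompletion L))) :
    classOrbitalIntegral m ((cmDatumLocalNonsplitCongr L w hw T ha h '' C).indicator fun _ => (1 : ℂ)) (ConjClasses.mk γ) =
      classOrbitalIntegral m (C.indicator fun _ => (1 : ℂ)) (ConjClasses.mk γ) := by
  refine hm.classOrbitalIntegral_indicator_image_eq_of_apply_eq (fun g x hg => isRegularElt_val_conj L N H v g x hg) _
    (map_cmDatumLocalNonsplitCongr_eq_self L N H w hw T ha h hσa ν) C hreg ?_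
  apply (localNonsplitEquiv (IsCMField.complexConj L) H (IsCMField.complexConj_ne_one L) w hw).injective
  apply Subtype.ext
  rw [coe_localNonsplitEquiv_cmDatumLocalNonsplitCongr, hcomm.eq, mul_inv_cancel_right]

/-! ## §2 The dictionary with ambient levels: `e_T {γ | γ_w ∈ S} = {γ | γ_w ∈ T S T⁻¹}` -/

omit [MeasurableSpace ((cmDatum L N H).Local v)] [BorelSpace ((cmDatum L N H).Local v)]
  [∀ γ : (cmDatum L N H).Local v, MeasurableSpace ((cmDatum L N H).Local v ⧸ Subgroup.centralizer ({γ} : Set ((cmDatum L N H).Local v)))]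
  [∀ γ : (cmDatum L N H).Local v, BorelSpace ((cmDatum L N H).Local v ⧸ Subgroup.centralizer ({γ} : Set ((cmDatum L N H).Local v)))] in
/-- **`Ad T` moves ambient levels**: for `S ≤ GL_N(L_w)`, the image under `e_T` of `C_S := {γ ∈ U(H)(L⁺_v) | γ_w ∈ S}` is
`C_{T S T⁻¹}` (`T S T⁻¹ = S.map (MulAut.conj T)`).  With `S = GL_N(𝒪_w)`: `C_S = K` hyperspecial (★ `unitaryInt_eq_comap`) and,
for `N = 2`, `T = d = diag(1, ϖ)`, `C_{d S d⁻¹} = K′` the stabiliser of the `ϖ`-modular vertex (the (R2) token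
`Subgroup.comap U_w.subtype ((glInt 2 L_w).map (MulAut.conj d).toMonoidHom)`, pulled back along ★ `localNonsplitEquiv`;
membership is definitionally `γ_w ∈ d S d⁻¹`). [cite: Kottwitz1988, §2] [cite: PlatonovRapinchuk1994, §2.3] -/
theorem image_cmDatumLocalNonsplitCongr_setOf_coe_mem (S : Subgroup (GL (Fin N) (w.1.adicCompletion L))) :
    cmDatumLocalNonsplitCongr L w hw T ha h ''
        {γ : (cmDatum L N H).Local v |
          ((localNonsplitEquiv (IsCMField.complexConj L) H (IsCMField.complexConj_ne_one L) w hw γ :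
            unitaryGroupOfForm (galAdicCompletionMap (L := L) (IsCMField.complexConj L) hw) (placeForm H w.1)) :
            GL (Fin N) (w.1.adicCompletion L)) ∈ S} =
      {γ : (cmDatum L N H).Local v |
        ((localNonsplitEquiv (IsCMField.complexConj L) H (IsCMField.complexConj_ne_one L) w hw γ :
          unitaryGroupOfForm (galAdicCompletionMap (L := L) (IsCMField.complexConj L) hw) (placeForm H w.1)) :
          GL (Fin N) (w.1.adicCompletion L)) ∈ S.map (MulAut.conj T).toMonoidHom} := by
  have himage : Set.image (cmDatumLocalNonsplitCongr L w hw T ha h : (cmDatum L N H).Local v → (cmDatum L N H).Local v) =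
      Set.preimage ((cmDatumLocalNonsplitCongr L w hw T ha h).symm : (cmDatum L N H).Local v → (cmDatum L N H).Local v) :=
    Set.image_eq_preimage_of_inverse (cmDatumLocalNonsplitCongr L w hw T ha h).symm_apply_apply
      (cmDatumLocalNonsplitCongr L w hw T ha h).apply_symm_apply
  rw [himage]
  ext γ
  rw [Set.mem_preimage, Set.mem_setOf_eq, Set.mem_setOf_eq, coe_localNonsplitEquiv_cmDatumLocalNonsplitCongr_symm,
    Subgroup.mem_map_equiv, MulAut.conj_symm_apply]

omit [∀ γ : (cmDatum L N H).Local v, MeasurableSpace ((cmDatum L N H).Local v ⧸ Subgroup.centralizer ({γ} : Set ((cmDatum L N H).Local v)))]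
  [∀ γ : (cmDatum L N H).Local v, BorelSpace ((cmDatum L N H).Local v ⧸ Subgroup.centralizer ({γ} : Set ((cmDatum L N H).Local v)))] in
include ha h in
/-- **`vol C_{T S T⁻¹} = vol C_S`** for every ambient level `S ≤ GL_N(L_w)` and every two-sided Haar `ν` on `U(H)(L⁺_v)` — on `U(Φ₂)`:
`ν K′ = ν K`, so the weights `(vol K)⁻¹`, `(vol K′)⁻¹` of `f_EP` agree. [cite: Kottwitz1988, §2] [cite: Folland1995, Thm. 2.20] -/
theorem measure_setOf_coe_mem_map_conj_eq (hσa : galAdicCompletionMap (L := L) (IsCMField.complexConj L) hw a = a)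
    (S : Subgroup (GL (Fin N) (w.1.adicCompletion L))) :
    ν {γ : (cmDatum L N H).Local v |
        ((localNonsplitEquiv (IsCMField.complexConj L) H (IsCMField.complexConj_ne_one L) w hw γ :
          unitaryGroupOfForm (galAdicCompletionMap (L := L) (IsCMField.complexConj L) hw) (placeForm H w.1)) :
          GL (Fin N) (w.1.adicCompletion L)) ∈ S.map (MulAut.conj T).toMonoidHom} =
      ν {γ : (cmDatum L N H).Local v |
        ((localNonsplitEquiv (IsCMField.complexConj L) H (IsCMField.complexConj_ne_one L) w hw γ :
          unitaryGroupOfForm (galAdicCompletionMap (L := L) (IsCMField.complexConj L) hw) (placeForm H w.1)) :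
          GL (Fin N) (w.1.adicCompletion L)) ∈ S} := by
  rw [← image_cmDatumLocalNonsplitCongr_setOf_coe_mem L N H w hw T ha h S]
  exact measure_image_cmDatumLocalNonsplitCongr_eq L N H w hw T ha h hσa ν _

/-- **HEAD, level form — `Φ(⟦γ⟧, 𝟙_{C_{T S T⁻¹}}; m) = Φ(⟦e_T⁻¹ γ⟧, 𝟙_{C_S}; m)`** for every ambient level `S ≤ GL_N(L_w)` and
every regular `γ` (`(e_T⁻¹ γ)_w = T⁻¹ γ_w T`): on `U(Φ₂)` with `S = GL_2(𝒪_w)`, `T = d`: `Φ(⟦γ⟧, 𝟙_{K′}) = Φ(⟦d⁻¹ γ d⟧, 𝟙_K)`.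
[cite: Kottwitz1988, §2] [cite: Rogawski1990, §4.3 (4.3.1) p. 43] -/
theorem classOrbitalIntegral_indicator_setOf_coe_mem_map_conj_eq
    (hσa : galAdicCompletionMap (L := L) (IsCMField.complexConj L) hw a = a)
    {m : OrbitalMeasureFamily ((cmDatum L N H).Local v)}
    (hm : m.IsCanonical (fun γ => IsRegularElt (γ.val : GL (Fin N) (LocalRing L v))) ν)
    (S : Subgroup (GL (Fin N) (w.1.adicCompletion L)))
    (γ : (cmDatum L N H).Local v) (hreg : IsRegularElt (γ.val : GL (Fin N) (LocalRing L v))) :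
    classOrbitalIntegral m
        ({γ' : (cmDatum L N H).Local v |
          ((localNonsplitEquiv (IsCMField.complexConj L) H (IsCMField.complexConj_ne_one L) w hw γ' :
            unitaryGroupOfForm (galAdicCompletionMap (L := L) (IsCMField.complexConj L) hw) (placeForm H w.1)) :
            GL (Fin N) (w.1.adicCompletion L)) ∈ S.map (MulAut.conj T).toMonoidHom}.indicator fun _ => (1 : ℂ))
        (ConjClasses.mk γ) =
      classOrbitalIntegral m
        ({γ' : (cmDatum L N H).Local v |
          ((localNonsplitEquiv (IsCMField.complexConj L) H (IsCMField.complexConj_ne_one L) w hw γ' :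
            unitaryGroupOfForm (galAdicCompletionMap (L := L) (IsCMField.complexConj L) hw) (placeForm H w.1)) :
            GL (Fin N) (w.1.adicCompletion L)) ∈ S}.indicator fun _ => (1 : ℂ))
        (ConjClasses.mk ((cmDatumLocalNonsplitCongr L w hw T ha h).symm γ)) := by
  rw [← image_cmDatumLocalNonsplitCongr_setOf_coe_mem L N H w hw T ha h S]
  exact classOrbitalIntegral_indicator_image_cmDatumLocalNonsplitCongr_eq L N H w hw T ha h ν hσa hm _ γ hreg

include ha h in
/-- **Level form at classes commuting with `T` — `Φ(⟦γ⟧, 𝟙_{C_{T S T⁻¹}}; m) = Φ(⟦γ⟧, 𝟙_{C_S}; m)`**: on `U(Φ₂)` with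
`S = GL_2(𝒪_w)`, `T = d = diag(1, ϖ)` and `γ_w` DIAGONAL (the split torus; ★ `commute_glDiagonal_of_coe_eq_diagonal`):
`Φ(⟦γ⟧, 𝟙_{K′}) = Φ(⟦γ⟧, 𝟙_K)` — the two vertex stabilisers have the same orbital integrals at the non-elliptic
diagonal classes. [cite: Kottwitz1988, §2] [cite: Rogawski1990, §4.3 (4.3.1) p. 43] -/
theorem classOrbitalIntegral_indicator_setOf_coe_mem_map_conj_eq_of_commute
    (hσa : galAdicCompletionMap (L := L) (IsCMField.complexConj L) hw a = a)
    {m : OrbitalMeasureFamily ((cmDatum L N H).Local v)}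
    (hm : m.IsCanonical (fun γ => IsRegularElt (γ.val : GL (Fin N) (LocalRing L v))) ν)
    (S : Subgroup (GL (Fin N) (w.1.adicCompletion L)))
    (γ : (cmDatum L N H).Local v) (hreg : IsRegularElt (γ.val : GL (Fin N) (LocalRing L v)))
    (hcomm : Commute T ((localNonsplitEquiv (IsCMField.complexConj L) H (IsCMField.complexConj_ne_one L) w hw γ :
        unitaryGroupOfForm (galAdicCompletionMap (L := L) (IsCMField.complexConj L) hw) (placeForm H w.1)) :
        GL (Fin N) (w.1.adicCompletion L))) :
    classOrbitalIntegral m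
        ({γ' : (cmDatum L N H).Local v |
          ((localNonsplitEquiv (IsCMField.complexConj L) H (IsCMField.complexConj_ne_one L) w hw γ' :
            unitaryGroupOfForm (galAdicCompletionMap (L := L) (IsCMField.complexConj L) hw) (placeForm H w.1)) :
            GL (Fin N) (w.1.adicCompletion L)) ∈ S.map (MulAut.conj T).toMonoidHom}.indicator fun _ => (1 : ℂ))
        (ConjClasses.mk γ) =
      classOrbitalIntegral m
        ({γ' : (cmDatum L N H).Local v |
          ((localNonsplitEquiv (IsCMField.complexConj L) H (IsCMField.complexConj_ne_one L) w hw γ' :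
            unitaryGroupOfForm (galAdicCompletionMap (L := L) (IsCMField.complexConj L) hw) (placeForm H w.1)) :
            GL (Fin N) (w.1.adicCompletion L)) ∈ S}.indicator fun _ => (1 : ℂ))
        (ConjClasses.mk γ) := by
  rw [← image_cmDatumLocalNonsplitCongr_setOf_coe_mem L N H w hw T ha h S]
  exact classOrbitalIntegral_indicator_image_cmDatumLocalNonsplitCongr_eq_of_commute L N H w hw T ha h ν hσa hm _ γ
    hreg hcomm

end CM

/-! ## §3 `U(Φ₂)`: the similitude `d = diag(1, ϖ)` and the diagonal split torus -/

section RankTwo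

variable (L : Type) [Field L] [NumberField L] [IsCMField L] {v : HeightOneSpectrum (𝓞 ↥(maximalRealSubfield L))}
  (w : PlacesOver L v) (hw : IsCMField.complexConj L • w.1 = w.1)

/-- **`d = diag(1, ϖ)` is a similitude of `Φ₂` with multiplier `ϖ`**: `ᵗ(σ_w d) Φ₂ d = ϖ Φ₂` for every `σ_w`-fixed `ϖ ≠ 0`
(`Φ₂` antidiagonal: the `(0,1)` entry picks up `σ_w(1) ϖ`, the `(1,0)` entry `σ_w(ϖ) 1`).  So §2 applies to
`T = glDiagonal 2 L_w ![1, ϖ]`, `a = ϖ` (§1–§2): `e_d = Ad d` is a Haar-preserving automorphism of `U(Φ₂)(L⁺_v)` of order two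
modulo inner automorphisms (so §1–§2 apply). [cite: Kottwitz1988, §2] [cite: Rogawski1990, §12.6 p. 174] -/
theorem formCongr_glDiagonal_one_eq_smul_placeForm_antidiag (ϖ : (w.1.adicCompletion L)ˣ)
    (hσϖ : galAdicCompletionMap (L := L) (IsCMField.complexConj L) hw (ϖ : w.1.adicCompletion L) = ϖ) :
    formCongr (galAdicCompletionMap (L := L) (IsCMField.complexConj L) hw) (glDiagonal 2 (w.1.adicCompletion L) ![1, ϖ])
        (placeForm (Matrix.of fun i j : Fin 2 => if i.val + j.val + 1 = 2 then (1 : L) else 0) w.1) =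
      (ϖ : w.1.adicCompletion L) • placeForm (Matrix.of fun i j : Fin 2 => if i.val + j.val + 1 = 2 then (1 : L) else 0) w.1 := by
  have hΦ : placeForm (Matrix.of fun i j : Fin 2 => if i.val + j.val + 1 = 2 then (1 : L) else 0) w.1 =
      Matrix.of fun i j : Fin 2 => if i.val + j.val + 1 = 2 then (1 : w.1.adicCompletion L) else 0 := by
    ext i j
    simp only [placeForm, Matrix.map_apply, Matrix.of_apply]
    split_ifs <;> simp
  rw [hΦ, formCongr, coe_glDiagonal, Matrix.diagonal_map (map_zero _), Matrix.diagonal_transpose]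
  ext i j
  rw [Matrix.mul_diagonal, Matrix.diagonal_mul, Matrix.smul_apply, Matrix.of_apply, smul_eq_mul]
  fin_cases i <;> fin_cases j <;> simp [hσϖ]

end RankTwo

end UnitaryGroup

end Literature.NumberTheory.Automorphic

end
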